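import Literature.MathematicalPhysics.QuantumFieldTheory.Balaban1983to89.B9Thm312WholeLeafCompletePairMBZS
import Literature.MathematicalPhysics.QuantumFieldTheory.Balaban1983to89.B9LettersZSchemasMono

/-!
# `Balaban1983to89.B9Thm312WholeLeafCompletePairMBZSR` — T. Bałaban, *Propagators for lattice gauge theories in a background field*, Commun. Math. Phys. **99** (1985)
# 389–434 [`Balaban1985BackgroundPropagators`], Theorem 3.12 (rows 20 of the N06 table): the row-20 leaf over the REGULAR state (`B9Thm312WholeLeafCompletePairMBZS`) with the
# STATE BLOCK DECOUPLED from Theorem 3.3's letters — the producers INTO the state classes and the sup readings carry their OWN constants and rates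

[4] = T. Bałaban, *Propagators and renormalization transformations for lattice gauge theories. II*, Commun. Math. Phys. **96** (1984) 223–250 [`Balaban1984PropagatorsII`].
statement-level skeleton of published theorems with citation tags; proofs where landed; nothing here is a claim about the Yang–Mills mass gap.

THE PRINT.  Thm 3.12 pp. 421–423 ((3.130), (3.138): the series over the induction state of Theorem 3.3's type); Thm 3.3 p. 399 and (3.42)–(3.47) pp. 397–398; p. 398, the
remark after (3.47): *"the powers of Lʲη may be moved"* between the two localizations ([4] Lemma 2.1 (2.60) p. 234) — each such move costs a fraction `αδ` of the decay
rate, so a producer INTO the state class obtained by moving powers (dag-n06-l g26 `B9SmoothHolderClassStateProducers`: shift to dimension 1, land, rescale back) decays at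
`δ₀ − 2αδ_F`, not at Theorem 3.3's `δ₀`.

WHY THIS FILE (cell `pub-ymgap`, node N06, bundle F7 rows 20–21, seat dag-n06-l g27; programme P-U8S step S4c).  `thm312Printed_completePairMBZS` names ONE rate `δ₀` for
Theorem 3.3's members (`he1`, `Thm33G0Dir`, `Thm33G0L2M`) AND for the state block's producers∕readings, and ONE pair `(B₃, δ₃)` for the letters of H (`LettersHZ`) AND for the
producer `G₀Q* : bZ → 𝔖₂`.  At the knit the producers come out of g26∕g27's landing lemmas with their own constants and the slower rates; rather than have the knit
re-instantiate `δ₀` and weaken five displayed schemas by hand, THIS FILE does it once: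
* §1 `thm33G0Dir_mono` (Theorem 3.3's direction-indexed schema at a slower rate) — the other weakenings are in the tree: dag-n06-w5's
  `B9LettersZSchemasMono.lettersHZ_mono ∕ lettersHHZ_mono` («constants up, rate down»), `thm33G0L2M_mono`, `hasMajorantHom_mono`, `HasMaj.mono`;
* §2 ★★★ `thm312Printed_completePairMBZS_rates` — the S-leaf VERBATIM except: the state block `hstate2 ∕ hstate1` is stated at a rate `δ_P ≤ δ₀` with producer constants
  `A₀` (G₀ → 𝔖₂), `A_Q, δ_Q ≤ δ₃` (G₀Q* → 𝔖₂), `A_D` (G₀∇* → 𝔖₁), `A_I ε` (G₀∇*_μ → 𝔖₁) and reading constants `C_R` (𝔖₂), `C_{R1}` (𝔖₁); the rate budget reads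
  `ρ + 2σ ≤ δ_P`, `ρ + 2σ ≤ δ_Q` (and `≤ δ_K` as before).  Proof: weaken Theorem 3.3's schemas and `he1` to `δ_P`, the letters of H to `(max B₃ A_Q, δ_Q)`, the producers to the
  max-constants, and apply `thm312Printed_completePairMBZS`.
HONEST SCOPE.  Bookkeeping (monotonicity of majorants in constant and rate) over the landed leaf; every analytic member stays a HYPOTHESIS of printed species; conclusion
`B9.Thm312Printed` unchanged; COUNT-NEUTRAL; N06 NOT discharged; nothing continuum ∕ OS positivity ∕ mass gap.  Cell `pub-ymgap` (HUMAN RULING D-0062), Track A node N06 [B9],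
seat `pub-ymgap-dag-n06-l` (g27), 2026-08-29.  NEW file; nothing landed is modified.
-/

namespace Literature.MathematicalPhysics.QuantumFieldTheory.Balaban1983to89.B9Thm312WholeLeafCompletePairMBZSR

open Literature.MathematicalPhysics.QuantumFieldTheory.Balaban1983to89
open Finset B6RandomWalk B6RandomWalkHom B9Thm34Ext B9Thm37Glue B9Thm37GlueCor36 B11SectG B9SectDSup B9SectDL2Decay
open B9Thm37AllNorms B9Thm37AllNormsInstances B9FromB6 B9FromB6ModelSignsOn B9SectBStepWhole B9Thm312Whole B9Thm312WholeLeaf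
open B9Thm312WholeLeft B9Thm312WholeH B9Thm312WholeLeafLeftGlob B9Ineq347CoReading B9SectCDiffDict B9CoRealizesRel B9CoRealizesHRel
open B9RWSums343Holder B9RWSumsReadsRel B9RWSumsReadsNbr B9Ineq347 B9Thm312WholeClasses B9Thm312WholeHolder B9Thm312WholeL2
open B9Thm312WholeBlocksRel B9Thm312WholeBlocksNbr B9Thm312WholeLeafAll B9Thm312WholeHHolder B9Thm312WholeHHolderNbr B9Thm312WholeLeafRelH
open B9RWSums346SecondDiff B9Thm312WholeLeafCompleteNbr B9Thm312WholeBlocksNbrRec B9RWSums344InputFam B9Thm312WholeDir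
open B9Thm312WholeBlocksPairM B9Thm312WholeLeafCompletePairM B9Thm312WholeDirB B9Thm312WholeBlocksPairMB B9Thm312WholeHZ B9Thm312WholeLeafRelHZ
open B9Thm312WholeStepRegular B9Thm312WholeStepDirRegular B9Thm312WholeMembersRegular B9Thm312WholeBlocksRegular B9Thm312WholeSeriesRegular
open B9Thm312WholeLeafRelHZM B9Thm312WholeLeafBlocksRegular B9Thm313WholeHolder B9Thm313WholeDir B9Thm312WholeLeafCompletePairMBZS
open B9LettersZSchemasMono

noncomputable section

/-! ## §1 Monotonicity of the displayed schemas in constant and rate -/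

section Mono

variable {g : B9.Geometry} {B : B9.Backgrounds} {X Y Z W PX PY : Type} {P : Type}
variable [Fintype X] [Fintype Y] [Fintype Z] [Fintype W] [Fintype PX] [Fintype PY] [Fintype P] [Fintype g.Site]
variable {R₀ : ℝ} {H₀ : Prop}

omit [Fintype Y] [Fintype Z] [Fintype W] [Fintype PY] [Fintype P] in
/-- Theorem 3.3's direction-indexed sup∕Hölder schema at a slower rate `δ₀′ ≤ δ₀` (`B₀, B_h(β), B_i(ε), B_i2(ε,β) ≥ 0`, `d ≥ 0`, `len ≥ 0`).
[cite: Balaban1985BackgroundPropagators, Thm 3.3 p.399 + (3.42)–(3.45) pp.397–398 (bookkeeping)] -/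
theorem thm33G0Dir_mono {𝔬 : Ops g B X Y Z W} {𝔭 : HolderProbes g B X Y PX PY} {Dd Dds : B.Cfg → P → Module.End ℝ (X → ℝ)}
    {bHX : ℝ → BlockNorm (toB6 g R₀ H₀) (X → ℝ)} {B₀ : ℝ} {Bh Bi : ℝ → ℝ} {Bi2 : ℝ → ℝ → ℝ} {δ₀ δ₀' : ℝ} {U : B.Cfg}
    (hG : GeoOK g) (hB₀ : 0 ≤ B₀) (hBh : ∀ β, 0 ≤ β → β < 1 → 0 ≤ Bh β) (hBi : ∀ ε, 0 < ε → ε ≤ 1 → 0 ≤ Bi ε)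
    (hBi2 : ∀ ε β, 0 < ε → ε ≤ 1 → 0 ≤ β → β < 1 → 0 ≤ Bi2 ε β) (hδ : δ₀' ≤ δ₀)
    (h : Thm33G0Dir 𝔬 𝔭 Dd Dds R₀ H₀ bHX B₀ Bh Bi Bi2 δ₀ U) : Thm33G0Dir 𝔬 𝔭 Dd Dds R₀ H₀ bHX B₀ Bh Bi Bi2 δ₀' U := by
  have hexp : ∀ y y' : g.Site, Real.exp (-(δ₀ * g.dist y y')) ≤ Real.exp (-(δ₀' * g.dist y y')) := fun y y' =>
    Real.exp_le_exp.mpr (neg_le_neg (mul_le_mul_of_nonneg_right hδ (hG.dnn y y')))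
  have hl : ∀ y : g.Site, 0 ≤ g.len y := hG.lenle
  exact
    { h43L := fun β hβ0 hβ1 => hasMajorantHom_mono (g := toB6 g R₀ H₀) _ _ (h.h43L β hβ0 hβ1) fun y y' =>
        mul_le_mul_of_nonneg_left (hexp y y') (mul_nonneg (hBh β hβ0 hβ1) (Real.rpow_nonneg (hl y) _))
      h43R := fun β hβ0 hβ1 => hasMajorantHom_mono (g := toB6 g R₀ H₀) _ _ (h.h43R β hβ0 hβ1) fun y y' =>
        mul_le_mul_of_nonneg_left (hexp y y') (mul_nonneg (hBh β hβ0 hβ1) (Real.rpow_nonneg (hl y) _))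
      e1d := fun ν => hasMajorantHom_mono (g := toB6 g R₀ H₀) _ _ (h.e1d ν) fun y y' =>
        mul_le_mul_of_nonneg_left (hexp y y') (mul_nonneg hB₀ (hl y))
      h43d := fun ν β hβ0 hβ1 => hasMajorantHom_mono (g := toB6 g R₀ H₀) _ _ (h.h43d ν β hβ0 hβ1) fun y y' =>
        mul_le_mul_of_nonneg_left (hexp y y') (mul_nonneg (hBh β hβ0 hβ1) (Real.rpow_nonneg (hl y) _))
      h44m := fun q ε hε0 hε1 => (h.h44m q ε hε0 hε1).mono fun y y' => mul_le_mul_of_nonneg_left (hexp y y') (hBi ε hε0 hε1)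
      h45m := fun q ε β hε0 hε1 hβ0 hβ1 => (h.h45m q ε β hε0 hε1 hβ0 hβ1).mono fun y y' =>
        mul_le_mul_of_nonneg_left (hexp y y') (mul_nonneg (hBi2 ε β hε0 hε1 hβ0 hβ1) (Real.rpow_nonneg (hl y) _)) }

end Mono

/-! ## §2 ★★★ The S-leaf with the state block at its own constants and rates -/

section Family

variable {I : Type} {d : ℕ} {c35 : ℝ} {geo : I → B9.Geometry} {bg : I → B9.Backgrounds}
variable [∀ i, Fintype (geo i).Site] [∀ i, DecidableEq (geo i).Site]
variable {X Y Z W PX PY : I → Type} {P : Type} [∀ i, Fintype (X i)] [∀ i, DecidableEq (X i)] [∀ i, Fintype (Y i)]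
  [∀ i, Fintype (Z i)] [∀ i, Fintype (W i)] [∀ i, Fintype (PX i)] [∀ i, Fintype (PY i)] [Fintype P]

/-- ★★★ **THEOREM 3.12, ROWS 20, OVER THE REGULAR STATE — THE STATE BLOCK AT ITS OWN CONSTANTS AND RATES.**  `thm312Printed_completePairMBZS` VERBATIM (same letters, same
readings, same conclusion `B9.Thm312Printed`) except that the state hypotheses `hstate2` (on 𝔖₂) and `hstate1` (on 𝔖₁) are stated at a rate `δ_P ≤ δ₀` — the rate at which
the tree's producers INTO the state classes land (g26 `hasMaj_into_state_of_sup_probes(_zero)`: `δ₀ − 2αδ_F`; g24 `hasMaj_into_bHZKPG_of_probeFamily`: `δ₀`) — with THEIR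
constants (no sign condition on the new ones — they enter through `max` with the displayed ones): `G₀ : 𝔠⁽⁰⁾ → 𝔖₂` (`A₀`), `G₀Q* : bZ → 𝔖₂` (`A_Q`, rate `δ_Q ≤ δ₃`), `G₀∇* : 𝔠_Y⁽⁰⁾ → 𝔖₁` (`A_D`), `G₀∇*_{U,μ} : bHX ε → 𝔖₁` (`A_I ε`), `id : 𝔖₂ → 𝔠^{(−2)}` (`C_R`),
`id : 𝔖₁ → 𝔠^{(−1)}` (`C_{R1}`); Theorem 3.3's members (`he1`, `hG0C`) stay at `(B₀, δ₀)` and the letters of H (`hlettersH`, `hLHH`) at `(B₃, B_q, δ₃)` AS DISPLAYED; the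
rate budget is `ρ + 2σ ≤ δ_P`, `ρ + 2σ ≤ δ_K`, `ρ + 2σ ≤ δ_Q`.  Proof: monotonicity (§1 and `B9LettersZSchemasMono`: Theorem 3.3 to `δ_P`, the letters of H to `(max B₃ A_Q, δ_Q)`, the producers and
readings to the max-constants) and `thm312Printed_completePairMBZS` at `δ₀ := δ_P`, `δ₃ := δ_Q`, `B₃ := max B₃ A_Q`, `A₀ := max A₀ A_D`, `C_R := max C_R C_{R1}`.
[cite: Balaban1985BackgroundPropagators, Thm 3.12 pp.421–423 + (3.39)–(3.47) pp.397–398 + p.398 (remark after (3.47)) + (3.126) p.420 + (3.132)–(3.133) p.422; Balaban1984PropagatorsII, (2.51)–(2.52) p.232 + Lemma 2.1 (2.60)–(2.61) p.234] -/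
theorem thm312Printed_completePairMBZS_rates (𝔬 : ∀ i, Ops (geo i) (bg i) (X i) (Y i) (Z i) (W i)) (R₀ : I → ℝ) (H₀ : I → Prop)
    (𝔭 : ∀ i, HolderProbes (geo i) (bg i) (X i) (Y i) (PX i) (PY i))
    (bHX : ∀ i, ℝ → BlockNorm (toB6 (geo i) (R₀ i) (H₀ i)) (X i → ℝ))
    (Dd Dds : ∀ i, (bg i).Cfg → P → Module.End ℝ (X i → ℝ))
    (GD G₁ : ∀ i, B9.KernelFamily (geo i) (bg i)) (Hk H₁k : ∀ i, B9.HKernel (geo i) (bg i))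
    (ev : ∀ i, (geo i).Loc → X i → ℝ) (evY : ∀ i, (geo i).Loc → Y i → ℝ) {PL : ∀ i, (geo i).Loc → Prop}
    (Rel : ∀ i, (geo i).Site → (geo i).Site → Prop) [∀ i, DecidableRel (Rel i)] (m mN : ℕ)
    (𝔖₂ 𝔖₁ : ∀ i, (bg i).Cfg → BlockNorm (toB6 (geo i) (R₀ i) (H₀ i)) (X i → ℝ))
    (r Cev CL θS θD θ₂ r₁ B₀ B₂ δ₀ δK σ c ρ ρf a₁ M₁ ML B₃ δ₃ α Lc κS A₀ CR δP δQ AQ AD CR₁ : ℝ) (Bh Bi Bq θH AI : ℝ → ℝ) (Bi2 : ℝ → ℝ → ℝ)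
    (hθS : 0 ≤ θS) (hθD : 0 ≤ θD) (hθH : ∀ β, 0 ≤ β → β < 1 → 0 ≤ θH β) (hθ₂ : 0 ≤ θ₂) (hr₁ : 0 ≤ r₁) (hB₀ : 0 ≤ B₀) (hB₂ : 0 ≤ B₂) (hB₃ : 0 ≤ B₃)
    (hκS : 1 ≤ κS) (hA₀ : 0 ≤ A₀) (hCR : 0 ≤ CR) (hAI : ∀ ε, 0 < ε → 0 ≤ AI ε)
    (hδP : δP ≤ δ₀) (hδQ : δQ ≤ δ₃)
    (hσ : 0 ≤ σ) (hρ : 0 < ρ) (hρS : ρ + 2 * σ ≤ δP) (hρδ : ρ + 2 * σ ≤ δK) (hρ₃ : ρ + 2 * σ ≤ δQ) (hc : 0 ≤ c) (ha₁ : 0 < a₁) (hM₁ : 0 < M₁)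
    (hα : α ≤ 1 / 2) (hα0 : 0 ≤ α) (hρf : 0 < ρf) (hρf1 : ρf + σ ≤ (1 - α) * ρ) (hρf2 : ρf + 2 * σ + α * ρ ≤ ρ)
    (hBh : ∀ β, 0 ≤ β → β < 1 → 0 ≤ Bh β) (hBi : ∀ ε, 0 < ε → ε ≤ 1 → 0 ≤ Bi ε)
    (hBi2 : ∀ ε β, 0 < ε → ε ≤ 1 → 0 ≤ β → β < 1 → 0 ≤ Bi2 ε β) (hBq : ∀ β, 0 ≤ Bq β)
    (hCev : 0 ≤ Cev) (hCL1 : 1 ≤ CL)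
    (hgeo : ∀ i, GeoOK (geo i)) (S : ∀ i, ModelSignsOn (geo i) (PL i))
    (hL1 : ∀ i, 1 ≤ (geo i).L) (hLle : ∀ i, (geo i).L ≤ Lc) (hLc : 1 ≤ Lc) (hη : ∀ i, 0 < (geo i).eta)
    (hrow : ∀ i, ML ≤ (geo i).M → RowSum (toB6 (geo i) (R₀ i) (H₀ i)) σ c)
    (hL21 : ∀ δ : ℝ, 0 < δ → ∃ ML' c' : ℝ, Lemma21AboveG geo R₀ H₀ δ α ML' c')
    (hnbr : ∀ (i : I) (y : (geo i).Site), (nbr (geo i) r y).card ≤ mN)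
    (hCL : ∀ (i : I) (a a' : (geo i).Site), (geo i).dist a a' ≤ r → (geo i).len a ≤ CL * (geo i).len a')
    (hsat : ∀ (i : I) (n : Fin 4) (B' δ' : ℝ),
      (∀ a a' b, Rel i a a' → maj342 (geo i) n B' δ' a b = maj342 (geo i) n B' δ' a' b) ∧
      (∀ a b b', Rel i b b' → maj342 (geo i) n B' δ' a b = maj342 (geo i) n B' δ' a b'))
    (hmult : ∀ (i : I) (y' : (geo i).Site), (Finset.univ.filter (fun y'' => Rel i y'' y')).card ≤ m)
    (hRdist : ∀ (i : I) (a a' b : (geo i).Site), Rel i a a' → (geo i).dist a b = (geo i).dist a' b)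
    (hRlen : ∀ (i : I) (a a' : (geo i).Site), Rel i a a' → (geo i).len a = (geo i).len a')
    (hcoR : ∀ (i : I) (U : (bg i).Cfg),
      CoRealizesRel (GD i) 0 U (Rel i) (𝔬 i).blk (𝔬 i).blk (ev i) ((𝔬 i).G U) ∧
      CoRealizesRel (GD i) 2 U (Rel i) (𝔬 i).blk (𝔬 i).blkY (evY i) ((𝔬 i).G U ∘ₗ (𝔬 i).Dstar U) ∧
      CoRealizesRel (G₁ i) 0 U (Rel i) (𝔬 i).blk (𝔬 i).blk (ev i) ((𝔬 i).G1 U) ∧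
      CoRealizesRel (G₁ i) 2 U (Rel i) (𝔬 i).blk (𝔬 i).blkY (evY i) ((𝔬 i).G1 U ∘ₗ (𝔬 i).Dstar U))
    (hco1R : ∀ (i : I) (U : (bg i).Cfg),
      CoRealizesRel (GD i) 1 U (Rel i) (𝔬 i).blkY (𝔬 i).blk (ev i) ((𝔬 i).D U ∘ₗ (𝔬 i).G U) ∧
      CoRealizesRel (G₁ i) 1 U (Rel i) (𝔬 i).blkY (𝔬 i).blk (ev i) ((𝔬 i).D U ∘ₗ (𝔬 i).G1 U))
    (hcoHR : ∀ (i : I) (U : (bg i).Cfg),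
      CoRealizesHRel (Hk i) 0 U d (Rel i) (𝔬 i).blk (𝔬 i).blkZ ((𝔬 i).Hm U) ∧
      CoRealizesHRel (Hk i) 1 U d (Rel i) (𝔬 i).blkY (𝔬 i).blkZ ((𝔬 i).D U ∘ₗ (𝔬 i).Hm U) ∧
      CoRealizesHRel (H₁k i) 0 U d (Rel i) (𝔬 i).blk (𝔬 i).blkZ ((𝔬 i).H1m U) ∧
      CoRealizesHRel (H₁k i) 1 U d (Rel i) (𝔬 i).blkY (𝔬 i).blkZ ((𝔬 i).D U ∘ₗ (𝔬 i).H1m U))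
    (hcoG : ∀ (i : I) (U : (bg i).Cfg),
      CoReadsGlob (GD i) 0 U (𝔬 i).blk (𝔬 i).blk (ev i) ((𝔬 i).G U) ∧
      CoReadsGlob (GD i) 1 U (𝔬 i).blkY (𝔬 i).blk (ev i) ((𝔬 i).D U ∘ₗ (𝔬 i).G U) ∧
      CoReadsGlob (GD i) 2 U (𝔬 i).blk (𝔬 i).blkY (evY i) ((𝔬 i).G U ∘ₗ (𝔬 i).Dstar U) ∧
      CoReadsGlob (G₁ i) 0 U (𝔬 i).blk (𝔬 i).blk (ev i) ((𝔬 i).G1 U) ∧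
      CoReadsGlob (G₁ i) 1 U (𝔬 i).blkY (𝔬 i).blk (ev i) ((𝔬 i).D U ∘ₗ (𝔬 i).G1 U) ∧
      CoReadsGlob (G₁ i) 2 U (𝔬 i).blk (𝔬 i).blkY (evY i) ((𝔬 i).G1 U ∘ₗ (𝔬 i).Dstar U))
    (hl2N : ∀ (i : I) (U : (bg i).Cfg),
      (L2ReadsNbr (R := R₀ i) (H := H₀ i) (GD i) 0 U (Rel i) r Cev (𝔬 i).blk (𝔬 i).blk (ev i) ((𝔬 i).G U) ∧
        L2ReadsNbr (R := R₀ i) (H := H₀ i) (GD i) 1 U (Rel i) r Cev (𝔬 i).blkY (𝔬 i).blk (ev i) ((𝔬 i).D U ∘ₗ (𝔬 i).G U) ∧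
        L2ReadsNbr (R := R₀ i) (H := H₀ i) (GD i) 2 U (Rel i) r Cev (𝔬 i).blk (𝔬 i).blkY (evY i) ((𝔬 i).G U ∘ₗ (𝔬 i).Dstar U) ∧
        L2ReadsNbr (R := R₀ i) (H := H₀ i) (GD i) 3 U (Rel i) r Cev ((𝔬 i).blk ∘ Prod.fst) (𝔬 i).blk (ev i)
          (familyOp (fun q : P × P => Dd i U q.1 ∘ₗ ((𝔬 i).G U ∘ₗ Dds i U q.2))) ∧
        L2ReadsNbr (R := R₀ i) (H := H₀ i) (GD i) 4 U (Rel i) r Cev ((𝔬 i).blk ∘ Prod.fst) (𝔬 i).blk (ev i)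
          (familyOp (fun q : P × P => (Dd i U q.1 ∘ₗ Dd i U q.2) ∘ₗ (𝔬 i).G U)) ∧
        L2ReadsNbr (R := R₀ i) (H := H₀ i) (GD i) 5 U (Rel i) r Cev ((𝔬 i).blk ∘ Prod.fst) (𝔬 i).blk (ev i)
          (familyOp (fun q : P × P => (𝔬 i).G U ∘ₗ (Dds i U q.1 ∘ₗ Dds i U q.2)))) ∧
      (L2ReadsNbr (R := R₀ i) (H := H₀ i) (G₁ i) 0 U (Rel i) r Cev (𝔬 i).blk (𝔬 i).blk (ev i) ((𝔬 i).G1 U) ∧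
        L2ReadsNbr (R := R₀ i) (H := H₀ i) (G₁ i) 1 U (Rel i) r Cev (𝔬 i).blkY (𝔬 i).blk (ev i) ((𝔬 i).D U ∘ₗ (𝔬 i).G1 U) ∧
        L2ReadsNbr (R := R₀ i) (H := H₀ i) (G₁ i) 2 U (Rel i) r Cev (𝔬 i).blk (𝔬 i).blkY (evY i) ((𝔬 i).G1 U ∘ₗ (𝔬 i).Dstar U) ∧
        L2ReadsNbr (R := R₀ i) (H := H₀ i) (G₁ i) 3 U (Rel i) r Cev ((𝔬 i).blk ∘ Prod.fst) (𝔬 i).blk (ev i)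
          (familyOp (fun q : P × P => Dd i U q.1 ∘ₗ ((𝔬 i).G1 U ∘ₗ Dds i U q.2))) ∧
        L2ReadsNbr (R := R₀ i) (H := H₀ i) (G₁ i) 4 U (Rel i) r Cev ((𝔬 i).blk ∘ Prod.fst) (𝔬 i).blk (ev i)
          (familyOp (fun q : P × P => (Dd i U q.1 ∘ₗ Dd i U q.2) ∘ₗ (𝔬 i).G1 U)) ∧
        L2ReadsNbr (R := R₀ i) (H := H₀ i) (G₁ i) 5 U (Rel i) r Cev ((𝔬 i).blk ∘ Prod.fst) (𝔬 i).blk (ev i)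
          (familyOp (fun q : P × P => (𝔬 i).G1 U ∘ₗ (Dds i U q.1 ∘ₗ Dds i U q.2)))))
    (hH1N : ∀ (i : I) (U : (bg i).Cfg),
      H1ReadsNbr (GD i) U (𝔭 i) (Rel i) r (𝔬 i).blk (𝔬 i).blkY (ev i) (evY i) ((𝔬 i).D U ∘ₗ (𝔬 i).G U)
        ((𝔬 i).G U ∘ₗ (𝔬 i).Dstar U) ∧
      H1ReadsNbr (G₁ i) U (𝔭 i) (Rel i) r (𝔬 i).blk (𝔬 i).blkY (ev i) (evY i) ((𝔬 i).D U ∘ₗ (𝔬 i).G1 U)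
        ((𝔬 i).G1 U ∘ₗ (𝔬 i).Dstar U))
    (hIF : ∀ (i : I) (U : (bg i).Cfg),
      InputReadsFam (GD i) U (bHX i) r ((𝔬 i).blk ∘ Prod.fst) ((𝔭 i).blkPX ∘ Prod.fst) (fun β => sliceProbe ((𝔭 i).ΦX U β)) (ev i)
        (familyOp (fun q : P × P => Dd i U q.1 ∘ₗ ((𝔬 i).G U ∘ₗ Dds i U q.2))) ∧
      InputReadsFam (G₁ i) U (bHX i) r ((𝔬 i).blk ∘ Prod.fst) ((𝔭 i).blkPX ∘ Prod.fst) (fun β => sliceProbe ((𝔭 i).ΦX U β)) (ev i)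
        (familyOp (fun q : P × P => Dd i U q.1 ∘ₗ ((𝔬 i).G1 U ∘ₗ Dds i U q.2))))
    (hHCN : ∀ (i : I) (U : (bg i).Cfg),
      CoReadsHHolderNbr (Hk i) U d (𝔭 i) r (𝔬 i).blkZ ((𝔬 i).D U ∘ₗ (𝔬 i).Hm U) ∧
      CoReadsHHolderNbr (H₁k i) U d (𝔭 i) r (𝔬 i).blkZ ((𝔬 i).D U ∘ₗ (𝔬 i).H1m U))
    (hsym : ∀ i, M₁ ≤ (geo i).M → ∀ α₀ : ℝ, 0 < α₀ → (geo i).M * α₀ ≤ a₁ →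
      ∀ U : (bg i).Cfg, (bg i).Reg335 c35 α₀ U → (bg i).Reg336 c35 α₀ U →
        (IsTransposePair ((𝔬 i).G U) ((𝔬 i).G U) ∧ IsTransposePair ((𝔬 i).G1 U) ((𝔬 i).G1 U)) ∧
        (IsTransposePair ((𝔬 i).D U ∘ₗ (𝔬 i).G U) ((𝔬 i).G U ∘ₗ (𝔬 i).Dstar U) ∧
          IsTransposePair ((𝔬 i).D U ∘ₗ (𝔬 i).G1 U) ((𝔬 i).G1 U ∘ₗ (𝔬 i).Dstar U)))
    (hmodel : ∀ i, M₁ ≤ (geo i).M → ∀ α₀ : ℝ, 0 < α₀ → (geo i).M * α₀ ≤ a₁ →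
      ∀ U : (bg i).Cfg, (bg i).Reg335 c35 α₀ U → (bg i).Reg336 c35 α₀ U →
        FormSmall (𝔬 i) (r₁ * ((geo i).M * α₀)) U ∧ Identities (𝔬 i) U)
    (he1 : ∀ i, M₁ ≤ (geo i).M → ∀ α₀ : ℝ, 0 < α₀ → (geo i).M * α₀ ≤ a₁ →
      ∀ U : (bg i).Cfg, (bg i).Reg335 c35 α₀ U → (bg i).Reg336 c35 α₀ U →
        HasMajorantHom (g := toB6 (geo i) (R₀ i) (H₀ i)) (𝔬 i).blk (𝔬 i).blkY ((𝔬 i).D U ∘ₗ (𝔬 i).G0 U)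
          (fun (a b : (geo i).Site) => B₀ * (geo i).len a * Real.exp (-(δ₀ * (geo i).dist a b))))
    (bZ : ∀ i, BlockNorm (toB6 (geo i) (R₀ i) (H₀ i)) (Z i → ℝ)) (hκZ : ∀ i, (bZ i).κ = 1)
    (hlettersH : ∀ i, M₁ ≤ (geo i).M → ∀ α₀ : ℝ, 0 < α₀ → (geo i).M * α₀ ≤ a₁ →
      ∀ U : (bg i).Cfg, (bg i).Reg335 c35 α₀ U → (bg i).Reg336 c35 α₀ U →
        LettersHZ (𝔬 i) (R₀ i) (H₀ i) (hgeo i) (bZ i) B₃ δ₃ U)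
    (hG0C : ∀ i, M₁ ≤ (geo i).M → ∀ α₀ : ℝ, 0 < α₀ → (geo i).M * α₀ ≤ a₁ →
      ∀ U : (bg i).Cfg, (bg i).Reg335 c35 α₀ U → (bg i).Reg336 c35 α₀ U →
        Thm33G0Dir (𝔬 i) (𝔭 i) (Dd i) (Dds i) (R₀ i) (H₀ i) (bHX i) B₀ Bh Bi Bi2 δ₀ U ∧
          Thm33G0L2M (𝔬 i) (Dd i) (Dds i) (R₀ i) (H₀ i) B₂ δ₀ U)
    (hStL : ∀ i, M₁ ≤ (geo i).M → ∀ α₀ : ℝ, 0 < α₀ → (geo i).M * α₀ ≤ a₁ →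
      ∀ U : (bg i).Cfg, (bg i).Reg335 c35 α₀ U → (bg i).Reg336 c35 α₀ U →
        StepL2 (𝔬 i) (R₀ i) (H₀ i) (θ₂ * ((geo i).M * α₀)) δK U)
    (hLHH : ∀ i, M₁ ≤ (geo i).M → ∀ α₀ : ℝ, 0 < α₀ → (geo i).M * α₀ ≤ a₁ →
      ∀ U : (bg i).Cfg, (bg i).Reg335 c35 α₀ U → (bg i).Reg336 c35 α₀ U →
        LettersHHZ (𝔬 i) (𝔭 i) (R₀ i) (H₀ i) (hgeo i).lenle (bZ i) Bq δ₃ U)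
    (hdomX : ∀ (i : I) (ε : ℝ), 0 < ε → (∀ y μ, (BlockNorm.ofBlocks (toB6 (geo i) (R₀ i) (H₀ i)) (𝔬 i).blk).loc y μ ≤ (bHX i ε).loc y μ) ∧
      (∀ y μ, (bHX i ε).IsLoc y μ → (BlockNorm.ofBlocks (toB6 (geo i) (R₀ i) (H₀ i)) (𝔬 i).blk).IsLoc y μ))
    (hstate2 : ∀ i, M₁ ≤ (geo i).M → ∀ α₀ : ℝ, 0 < α₀ → (geo i).M * α₀ ≤ a₁ →
      ∀ U : (bg i).Cfg, (bg i).Reg335 c35 α₀ U → (bg i).Reg336 c35 α₀ U →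
        StepS (𝔬 i) (𝔖₂ i U) (θS * ((geo i).M * α₀)) δK U ∧
        (HasMaj (𝔖₂ i U) (cNorm (R₀ i) (H₀ i) (𝔬 i).blkY (hgeo i).lenle 1) ((𝔬 i).D U ∘ₗ (𝔬 i).G0 U ∘ₗ (𝔬 i).Tpi U)
            (fun a b => θD * ((geo i).M * α₀) * Real.exp (-(δK * (geo i).dist a b))) ∧
          HasMaj (𝔖₂ i U) (cNorm (R₀ i) (H₀ i) (𝔬 i).blkY (hgeo i).lenle 1) ((𝔬 i).D U ∘ₗ (𝔬 i).G0 U ∘ₗ ((𝔬 i).Tpi U + (𝔬 i).T2 U))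
            (fun a b => θD * ((geo i).M * α₀) * Real.exp (-(δK * (geo i).dist a b)))) ∧
        (∀ β : ℝ, 0 ≤ β → β < 1 →
          HasMaj (𝔖₂ i U) (cNormR (R₀ i) (H₀ i) (𝔭 i).blkPY (hgeo i).lenle (β - 1)) (((𝔭 i).ΦY U β ∘ₗ (𝔬 i).D U ∘ₗ (𝔬 i).G0 U) ∘ₗ (𝔬 i).Tpi U)
              (fun a b => θH β * ((geo i).M * α₀) * Real.exp (-(δK * (geo i).dist a b))) ∧
            HasMaj (𝔖₂ i U) (cNormR (R₀ i) (H₀ i) (𝔭 i).blkPY (hgeo i).lenle (β - 1))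
              (((𝔭 i).ΦY U β ∘ₗ (𝔬 i).D U ∘ₗ (𝔬 i).G0 U) ∘ₗ ((𝔬 i).Tpi U + (𝔬 i).T2 U))
              (fun a b => θH β * ((geo i).M * α₀) * Real.exp (-(δK * (geo i).dist a b)))) ∧
        HasMaj (cNorm (R₀ i) (H₀ i) (𝔬 i).blk (hgeo i).lenle 0) (𝔖₂ i U) ((𝔬 i).G0 U)
          (fun a b => A₀ * Real.exp (-(δP * (geo i).dist a b))) ∧
        HasMaj (bZ i) (𝔖₂ i U) ((𝔬 i).G0 U ∘ₗ (𝔬 i).Qstar U) (fun a b => AQ * Real.exp (-(δQ * (geo i).dist a b))) ∧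
        HasMaj (𝔖₂ i U) (cNormR (R₀ i) (H₀ i) (𝔬 i).blk (hgeo i).lenle (-2)) LinearMap.id
          (fun a b => CR * Real.exp (-(δP * (geo i).dist a b))) ∧
        (𝔖₂ i U).κ ≤ κS ∧
        (∃ Λ : ℝ, 0 ≤ Λ ∧ ∀ (y : (geo i).Site) (F : X i → ℝ), (𝔖₂ i U).loc y F ≤ Λ * ∑ x : X i, |F x|))
    (hstate1 : ∀ i, M₁ ≤ (geo i).M → ∀ α₀ : ℝ, 0 < α₀ → (geo i).M * α₀ ≤ a₁ →
      ∀ U : (bg i).Cfg, (bg i).Reg335 c35 α₀ U → (bg i).Reg336 c35 α₀ U →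
        StepS (𝔬 i) (𝔖₁ i U) (θS * ((geo i).M * α₀)) δK U ∧
        (∀ ν : P,
          HasMaj (𝔖₁ i U) (cNormR (R₀ i) (H₀ i) (𝔬 i).blk (hgeo i).lenle 0) (Dd i U ν ∘ₗ (𝔬 i).G0 U ∘ₗ (𝔬 i).Tpi U)
              (fun a b => θD * ((geo i).M * α₀) * Real.exp (-(δK * (geo i).dist a b))) ∧
            HasMaj (𝔖₁ i U) (cNormR (R₀ i) (H₀ i) (𝔬 i).blk (hgeo i).lenle 0) (Dd i U ν ∘ₗ (𝔬 i).G0 U ∘ₗ ((𝔬 i).Tpi U + (𝔬 i).T2 U))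
              (fun a b => θD * ((geo i).M * α₀) * Real.exp (-(δK * (geo i).dist a b)))) ∧
        (∀ β : ℝ, 0 ≤ β → β < 1 →
          HasMaj (𝔖₁ i U) (cNormR (R₀ i) (H₀ i) (𝔭 i).blkPX (hgeo i).lenle (β - 1)) (((𝔭 i).ΦX U β ∘ₗ (𝔬 i).G0 U) ∘ₗ (𝔬 i).Tpi U)
              (fun a b => θH β * ((geo i).M * α₀) * Real.exp (-(δK * (geo i).dist a b))) ∧
            HasMaj (𝔖₁ i U) (cNormR (R₀ i) (H₀ i) (𝔭 i).blkPX (hgeo i).lenle (β - 1)) (((𝔭 i).ΦX U β ∘ₗ (𝔬 i).G0 U) ∘ₗ ((𝔬 i).Tpi U + (𝔬 i).T2 U))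
              (fun a b => θH β * ((geo i).M * α₀) * Real.exp (-(δK * (geo i).dist a b)))) ∧
        (∀ (ν : P) (β : ℝ), 0 ≤ β → β < 1 →
          HasMaj (𝔖₁ i U) (cNormR (R₀ i) (H₀ i) (𝔭 i).blkPX (hgeo i).lenle β) (((𝔭 i).ΦX U β ∘ₗ Dd i U ν ∘ₗ (𝔬 i).G0 U) ∘ₗ (𝔬 i).Tpi U)
              (fun a b => θH β * ((geo i).M * α₀) * Real.exp (-(δK * (geo i).dist a b))) ∧
            HasMaj (𝔖₁ i U) (cNormR (R₀ i) (H₀ i) (𝔭 i).blkPX (hgeo i).lenle β) (((𝔭 i).ΦX U β ∘ₗ Dd i U ν ∘ₗ (𝔬 i).G0 U) ∘ₗ ((𝔬 i).Tpi U + (𝔬 i).T2 U))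
              (fun a b => θH β * ((geo i).M * α₀) * Real.exp (-(δK * (geo i).dist a b)))) ∧
        HasMaj (cNormR (R₀ i) (H₀ i) (𝔬 i).blkY (hgeo i).lenle 0) (𝔖₁ i U) ((𝔬 i).G0 U ∘ₗ (𝔬 i).Dstar U)
          (fun a b => AD * Real.exp (-(δP * (geo i).dist a b))) ∧
        (∀ (μ : P) (ε : ℝ), 0 < ε → HasMaj (bHX i ε) (𝔖₁ i U) ((𝔬 i).G0 U ∘ₗ Dds i U μ)
          (fun a b => AI ε * Real.exp (-(δP * (geo i).dist a b)))) ∧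
        HasMaj (𝔖₁ i U) (cNormR (R₀ i) (H₀ i) (𝔬 i).blk (hgeo i).lenle (-1)) LinearMap.id
          (fun a b => CR₁ * Real.exp (-(δP * (geo i).dist a b))) ∧
        (𝔖₁ i U).κ ≤ κS ∧
        (∃ Λ : ℝ, 0 ≤ Λ ∧ ∀ (y : (geo i).Site) (F : X i → ℝ), (𝔖₁ i U).loc y F ≤ Λ * ∑ x : X i, |F x|)) :
    B9.Thm312Printed d c35 geo bg GD G₁ Hk H₁k (fun i => HasRWExpOfOps (𝔬 i)) (fun i => HasRWExpHOfOps (𝔬 i))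
      (fun i => PosDefKOfOps (𝔬 i)) := by
  classical
  -- the max-constants and their comparisons
  have hB₃' : 0 ≤ max B₃ AQ := le_max_of_le_left hB₃
  have hA₀' : 0 ≤ max A₀ AD := le_max_of_le_left hA₀
  have hCR' : 0 ≤ max CR CR₁ := le_max_of_le_left hCR
  refine thm312Printed_completePairMBZS 𝔬 R₀ H₀ 𝔭 bHX Dd Dds GD G₁ Hk H₁k ev evY Rel m mN 𝔖₂ 𝔖₁
    r Cev CL θS θD θ₂ r₁ B₀ B₂ δP δK σ c ρ ρf a₁ M₁ ML (max B₃ AQ) δQ α Lc κS (max A₀ AD) (max CR CR₁) Bh Bi Bq θH AI Bi2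
    hθS hθD hθH hθ₂ hr₁ hB₀ hB₂ hB₃' hκS hA₀' hCR' hAI hσ hρ hρS hρδ hρ₃ hc ha₁ hM₁ hα hα0 hρf hρf1 hρf2 hBh hBi hBi2 hBq hCev hCL1
    hgeo S hL1 hLle hLc hη hrow hL21 hnbr hCL hsat hmult hRdist hRlen hcoR hco1R hcoHR hcoG hl2N hH1N hIF hHCN hsym hmodel
    (fun i hM α₀ hα₀ hMa U hU hU' => hasMajorantHom_mono (g := toB6 (geo i) (R₀ i) (H₀ i)) _ _ (he1 i hM α₀ hα₀ hMa U hU hU') fun y y' =>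
      mul_le_mul_of_nonneg_left (Real.exp_le_exp.mpr (neg_le_neg (mul_le_mul_of_nonneg_right hδP ((hgeo i).dnn y y'))))
        (mul_nonneg hB₀ ((hgeo i).lenle y)))
    bZ hκZ
    (fun i hM α₀ hα₀ hMa U hU hU' => lettersHZ_mono (hgeo i) hB₃ (le_max_left _ _) hδQ (hlettersH i hM α₀ hα₀ hMa U hU hU'))
    (fun i hM α₀ hα₀ hMa U hU hU' => ⟨thm33G0Dir_mono (hgeo i) hB₀ hBh hBi hBi2 hδP (hG0C i hM α₀ hα₀ hMa U hU hU').1,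
      thm33G0L2M_mono (hgeo i) hB₂ hδP (hG0C i hM α₀ hα₀ hMa U hU hU').2⟩)
    hStL
    (fun i hM α₀ hα₀ hMa U hU hU' => lettersHHZ_mono (hgeo i) (fun β _ _ => hBq β) (fun β _ _ => le_rfl) hδQ (hLHH i hM α₀ hα₀ hMa U hU hU'))
    hdomX
    (fun i hM α₀ hα₀ hMa U hU hU' => ?_) (fun i hM α₀ hα₀ hMa U hU hU' => ?_)
  · -- the state block on 𝔖₂: producers at the max-constants
    obtain ⟨hS, hD, hY, hP0, hPQ, hR, hκ, hΛ⟩ := hstate2 i hM α₀ hα₀ hMa U hU hU'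
    refine ⟨hS, hD, hY, hP0.mono fun y y' => ?_, hPQ.mono fun y y' => ?_, hR.mono fun y y' => ?_, hκ, hΛ⟩
    · exact mul_le_mul_of_nonneg_right (le_max_left _ _) (Real.exp_nonneg _)
    · exact mul_le_mul_of_nonneg_right (le_max_right _ _) (Real.exp_nonneg _)
    · exact mul_le_mul_of_nonneg_right (le_max_left _ _) (Real.exp_nonneg _)
  · -- the state block on 𝔖₁
    obtain ⟨hS, hD, hX, hXd, hPD, hPI, hR, hκ, hΛ⟩ := hstate1 i hM α₀ hα₀ hMa U hU hU'
    refine ⟨hS, hD, hX, hXd, hPD.mono fun y y' => ?_, hPI, hR.mono fun y y' => ?_, hκ, hΛ⟩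
    · exact mul_le_mul_of_nonneg_right (le_max_right _ _) (Real.exp_nonneg _)
    · exact mul_le_mul_of_nonneg_right (le_max_right _ _) (Real.exp_nonneg _)

end Family

end

end Literature.MathematicalPhysics.QuantumFieldTheory.Balaban1983to89.B9Thm312WholeLeafCompletePairMBZSR
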